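import Literature.AlgebraicGeometry.Motives.CrystallineRealization
import Literature.AlgebraicGeometry.Motives.SupersingularAbelianVariety
import Literature.AlgebraicGeometry.Motives.FamiliesVHS
import Literature.AlgebraicGeometry.HodgeTheory.HodgeLocus
import Literature.AlgebraicGeometry.HodgeTheory.GlobalInvariantCycles
import Literature.AlgebraicGeometry.HodgeTheory.HodgeModelExistence
import Literature.AlgebraicGeometry.Crystalline.BlochEsnaultKerzLifting
import Literature.AlgebraicGeometry.KTheory.GrothendieckGroup
import HarnessLib

/-!
# Supersingular `p`-adic anchors of a complex variety: models, anchors, seed statements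

The vocabulary of the `p`-adic deformation approach to the Hodge conjecture for abelian varieties
(Bloch–Esnault–Kerz 2014, §1: lift classes / objects from a supersingular special fibre over `W(k)`,
then algebraize), as used by the tree's route `HodgeConjecture/PadicSemiregularLift` and its crux line
`inner-form-invariant-seeds` (crux `HodgeAbelianVarieties`). This module is the importable, sorry-free
DEFINITIONS layer of that line: it copies the line's kernel-checked vocabulary verbatim, over
Literature carriers only (`CrystallineRealization`, `WittScheme.*`, `KZero`,
`AbelianVariety.IsSupersingular`, `complexBetti`, `IsOfHodgeType`, `IsDefinedOverQbar`, …), so that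
route items can be one-line `Prop`s over these declarations and the route file can import it.

Contents: `PadicModel n X` (supersingular `p`-adic model of a complex `n`-fold: `p > n + 6`, `k = k̄`,
smooth proper `𝒴 / W(k)` with supersingular abelian special fibre, `ι : W(k)[1/p] → ℂ`,
`X ≅ Y_K ⊗_ι ℂ`); `Anchor n X` (model + crystalline realization `C` + period comparison `cmp`) with
`Anchor.IsGenuine` (the classical facts the composition consumes), `Anchor.UHdg`,
`Anchor.anchoredClasses`, `Anchor.SpansHodge`, `Anchor.hodgeDR`, `Anchor.HodgeSpanDescends`,
`Anchor.InnerFormIdentity` (Kisin's inner form), `Anchor.UHdgAreHodge`, `Anchor.CycleDescent`;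
predicates of a realization `C` (explicit binder — the named-fact pattern of
`Motives/CrystallineRealization`): `SpecializationOfCycles`, `DivisorClassesAreChern`,
`RationallyLefschetz`, `starSeedClasses`/`StarSeedsFor`, `formalSeedClasses`/`FormalSeedsFor`,
`RationalPVHCFor`, and the `C`-free `ClassLiftsImplyObjectLifts` ((⋆)) and `ModelHypotheses` of the
route crux `FormalLiftingFromClassLifting`, verbatim; complex side `bettiHodgeFil`, `hodgeSpan`,
`IsQbarGeneric`, `ExtendsHodgeClasses`, `MiddleCyclePart`; the line's four closed statements as
predicates `InnerFormAnchorsFor A`, `StarSeedsAt C`, `FormalSeedsAt C`, `RationalPVHCAt C` (below); and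
proved glue at one anchor (`Anchor.modelHypotheses`, `spansHodge_of_residual`,
`anchoredClasses_subset_algebraicClasses`, `rationalPVHCFor_of_rationalPVHCAt`,
`middleCyclePart_of_rationalPVHCFor`, `rationalPVHCFor_of_middleCyclePart`,
`rationalPVHCFor_iff_middleCyclePart` — tightness in the middle degrees).

## Design

* Verbatim copy of the line skeleton `Summits/HodgeConjecture/HodgeConjecture/Cruxes/
  HodgeAbelianVarieties/Lines/inner-form-invariant-seeds.lean` (gen 3 + Glue IV), namespace
  `…Cruxes.HodgeAbelianVarieties.InnerFormInvariantSeeds`; consumers `open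
  Literature.AlgebraicGeometry.Crystalline.PadicAnchor` and keep their text unchanged. Universe `0`
  (`k : Type`) as there and as in the route items that consume these predicates.
* Closed statements are NOT vendored as `def X : Prop` (in `Literature/` a closed `Prop` is a named
  FACT carrying a discharge debt, and an open one is a conjecture, which does not live here): the
  line's `InnerFormAnchors`, `StarSeeds`, `FormalSeeds`, `RationalPVHC` are, definitionally,
  `∀ A, InnerFormAnchorsFor A` and
  `∀ (p) [Fact p.Prime] (k : Type) [Field k] [CharP k p] [PerfectRing k p] [IsAlgClosed k]
     (C : CrystallineRealization p k), StarSeedsAt C` (resp. `FormalSeedsAt C`, `RationalPVHCAt C`)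
  — one-line `Prop`s over this module, to be written where obligations live (route items).
* Nothing here is asserted: every `Prop` is a predicate with explicit subject (`C`, `D`, `A`, `𝒴`),
  consumed as a hypothesis; no value of `CrystallineRealization` (hence of `Anchor`) is constructible
  in Mathlib, so non-vacuity cannot be witnessed in Lean (positive-dimensional smooth proper models
  over `W(k)` have no instance in the tree either).

## What is NOT here

* The line's two `sorry` stubs and everything consuming route items by name (the engine
  `StarSeedsFor ⟹ FormalSeedsFor ⟹ RationalPVHCFor` through `FormalLiftingFromClassLifting` /
  `FormalVectorBundlesAlgebraize`, and the composition `HodgeAbelianVarieties_of`): Literature does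
  not import `Summits`; they stay in the skeleton and in
  `Theorems/PadicSemiregularLiftHodgeAbelianVarietiesStarSeedsEngine.lean`.
* The extreme codimensions (`r = 0`, `r ≥ n`: `mem_algebraicClasses_of_extreme`, `Anchor.cyclePart`,
  `rationalPVHCFor_iff_hodgeConjectureFor`), whose ingredients (`mem_algebraicClasses_of_degree_top`,
  `ComplexPoints.subsingleton_singularCohomology_of_lt`) lie outside this module's import cone.

## References

* S. Bloch, H. Esnault, M. Kerz, *p-adic deformation of algebraic cycle classes*, Invent. Math. 195
  (2014), §1, Thm. 1.3. [BlochEsnaultKerz2014pAdic]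
* P. Berthelot, A. Ogus, *F-isocrystals and de Rham cohomology. I*, Invent. Math. 72 (1983), Thm. 2.4,
  Cor. 2.5, Rem. 3.7.1, Thm. 3.8. [BerthelotOgus1983]
* M. Kisin, *Mod p points on Shimura varieties of abelian type*, JAMS 30 (2017), §2.1 (2.1.2),
  Cor. 2.3.1, 2.3.2, 2.3.5 (the group `I` of a mod-`p` point, `I ⊗ ℚ_p ≅ I_p ⊂ J_δ`, `I` an inner
  form). [Kisin2017]
* P. Deligne, *Hodge cycles on abelian varieties*, LNM 900 (1982), Main Thm. 2.11. [Deligne1982HodgeCycles]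
* P. Deligne, *Théorie de Hodge II*, Thm. 4.1.1; F. Charles, C. Schnell, *Notes on absolute Hodge
  classes*, Thm. 11.3.4, Prop. 11.3.5. [DeligneHodgeII1971, CharlesSchnell2014Notes]
* H. W. Lenstra, Yu. G. Zarhin, *The Tate conjecture for almost ordinary abelian varieties over finite
  fields* (1993), §1 pp. 179–180; A. Ogus, *Hodge cycles and crystalline cohomology*, LNM 900 (1982),
  §4. [LenstraZarhin1993, Ogus1982]
* W. Fulton, *Intersection theory*, §20.3; H. Gillet, W. Messing, *Cycle classes and Riemann–Roch for
  crystalline cohomology* (1987); M. Gros (1985). [Fulton1998, GilletMessing1987, Gros1985]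
* P. Deligne, J. Milne, *Tannakian categories*, in LNM 900 (1982), I §1. [DeligneMilne1982]
-/

noncomputable section

open CategoryTheory AlgebraicGeometry
open scoped Isocrystal
open Literature.AlgebraicGeometry.Motives Literature.AlgebraicGeometry.HodgeTheory
  Literature.AlgebraicGeometry.KTheory

namespace Literature.AlgebraicGeometry.Crystalline.PadicAnchor

/-! ### `p`-adic side: models and anchors (real carriers `WittScheme`, `AbelianVariety`, `IsSupersingular`) -/

/-- A **supersingular `p`-adic model** of a complex `n`-fold `X` (real carriers only, no
cohomology): a prime `p` with `n + 6 < p` (the bound of Bloch–Esnault–Kerz 2014, Thm. 1.3), an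
algebraically closed field `k` of characteristic `p` (intended `𝔽̄_p`), a smooth proper model
`𝒴 / W(k)` of relative dimension `n` (`WittScheme.IsSmoothProperModel`) whose special fibre is (the
underlying scheme of) a SUPERSINGULAR abelian variety `A₀ / k` (`AbelianVariety.IsSupersingular`:
`A₀ ⊗ k̄ ~ Eⁿ`), and a ring embedding `ι : K = W(k)[1/p] → ℂ` along which the generic fibre becomes
`X`: `X ≅ Y_K ⊗_{K,ι} ℂ`. Route-posited packaging (`HodgeConjecture/PadicSemiregularLift`, line
`inner-form-invariant-seeds`) of the setting "`X/W` smooth projective, `p > d + 6`" of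
Bloch–Esnault–Kerz at a supersingular abelian special fibre. [cite: BlochEsnaultKerz2014pAdic, §1 and Thm. 1.3] -/
structure PadicModel (n : ℕ) (X : SchemeOver ℂ) where
  /-- the residue characteristic -/
  p : ℕ
  [prime : Fact p.Prime]
  /-- the Bloch–Esnault–Kerz bound `n < p - 6` -/
  large : n + 6 < p
  /-- the residue field (intended `𝔽̄_p`) -/
  k : Type
  [field : Field k]
  [charP : CharP k p]
  [perfect : PerfectRing k p]
  [algClosed : IsAlgClosed k]
  /-- the model over `W(k)` -/
  𝒴 : SchemeOver (WittVector p k)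
  /-- `𝒴 / W(k)` is a smooth proper model of relative dimension `n` -/
  model : WittScheme.IsSmoothProperModel n 𝒴
  /-- the special fibre as an abelian variety over `k` -/
  A₀ : AbelianVariety k
  /-- the underlying `k`-scheme of `A₀` is the special fibre of `𝒴` -/
  special_eq : A₀.X = WittScheme.specialFibre 𝒴
  /-- `A₀` is supersingular -/
  supersingular : A₀.IsSupersingular
  /-- the complex embedding of `K = W(k)[1/p]` -/
  ι : K(p, k) →+* ℂ
  /-- `X ≅ Y_K ⊗_{K,ι} ℂ` -/
  iso : Nonempty (X ≅ (baseChangeHom ι).obj (WittScheme.genericFibre 𝒴))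

-- The bundled instances of a model's OWN carriers `M.p`, `M.k` (new types/data, so nothing in the
-- library is overridden): needed to write `K(M.p, M.k)`, `CrystallineRealization M.p M.k`, … below.
attribute [instance] PadicModel.prime PadicModel.field PadicModel.charP PadicModel.perfect
  PadicModel.algClosed

/-- An **anchor** of the complex `n`-fold `X`: a supersingular `p`-adic model together with the
`p`-adic cohomological package — a crystalline realization `C` over `k` (the hypothesis structure
`CrystallineRealization p k`: rational crystalline cohomology, Frobenius, an algebraic de Rham
realization of `K`-varieties and the Berthelot–Ogus maps `bo`, Berthelot–Ogus 1983, Thm. 2.4,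
Cor. 2.5) and a period comparison `cmp i : Hⁱ_dR(Y_K/K) →ₛₗ[ι] Hⁱ(X(ℂ); ℂ)` (intended: Grothendieck's
algebraic de Rham theorem + GAGA + base change along `ι` + `X ≅ Y_K ⊗_ι ℂ`). INTERFACE ONLY: which
values are meant is recorded by `Anchor.IsGenuine`; anchors are only ever asserted to exist
existentially, per abelian variety (`InnerFormAnchorsFor`). [cite: BerthelotOgus1983, Thm. 2.4 and Cor. 2.5] -/
structure Anchor (n : ℕ) (X : SchemeOver ℂ) extends PadicModel n X where
  /-- crystalline realization over `k` (intended: Berthelot's, with the Berthelot–Ogus comparison) -/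
  C : CrystallineRealization p k
  /-- period comparison (intended: Grothendieck's algebraic de Rham theorem + GAGA + base change
  along `ι` + the iso `X ≅ Y_K ⊗_ι ℂ`) -/
  cmp : ∀ i : ℕ, C.dR.obj (WittScheme.genericFibre 𝒴) i →ₛₗ[ι] complexBetti X i

namespace Anchor

variable {n : ℕ} {X : SchemeOver ℂ}

/-- `U_Hdg` in degree `2r` at the anchor `D`: the RATIONAL algebraic classes `u` of the special
fibre whose Berthelot–Ogus image lies in `Fʳ H²ʳ_dR(Y_K/K)` — "rational special-fibre classes that are
Hodge at the lift" (the targets of Bloch–Esnault–Kerz 2014, Thm. 1.3 (a), at the level of cycle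
classes). [cite: BlochEsnaultKerz2014pAdic, Thm. 1.3 (a)] -/
def UHdg (D : Anchor n X) (r : ℕ) : Set (D.C.obj (WittScheme.specialFibre D.𝒴) (2 * r)) :=
  {u | u ∈ D.C.ratAlgebraicClasses (WittScheme.specialFibre D.𝒴) r ∧
    D.C.bo D.𝒴 (2 * r) u ∈ D.C.dR.fil (2 * r) r}

/-- The image of `U_Hdg` in complex cohomology: `cmp ∘ bo (U_Hdg)`.
[cite: BlochEsnaultKerz2014pAdic, Thm. 1.3 (a)] -/
def anchoredClasses (D : Anchor n X) (r : ℕ) : Set (complexBetti X (2 * r)) :=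
  (fun u => D.cmp (2 * r) (D.C.bo D.𝒴 (2 * r) u)) '' D.UHdg r

/-- **SPANNING** at the anchor `D` (the OUTPUT of Kisin's inner-form lever at the anchors of
`InnerFormAnchorsFor`, see `spansHodge_of_residual`): every rational class of Hodge type `(r,r)` on
`X` lies in the `ℂ`-span of `cmp ∘ bo (U_Hdg)`. A predicate on `D`, never asserted for every anchor.
[cite: Kisin2017, §2.1 (2.1.2) and Cor. 2.3.2, 2.3.5] -/
def SpansHodge (D : Anchor n X) : Prop :=
  ∀ (r : ℕ) (c : complexBetti X (2 * r)), IsRationalClass c → IsOfHodgeType n X (2 * r) r r c →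
    c ∈ Submodule.span ℂ (D.anchoredClasses r)

end Anchor

/-- The Betti Hodge filtration step `Fʳ H²ʳ(X(ℂ); ℂ)` rendered over the tree's `IsOfHodgeType`: the
`ℂ`-span of the classes of pure type `(a, b)`, `a + b = 2r`, `a ≥ r` (`Fʳ = ⊕_{a ≥ r} H^{a,b}`).
[cite: VoisinHodgeI2002, §7.1.1] -/
def bettiHodgeFil (n : ℕ) (X : SchemeOver ℂ) (r : ℕ) : Submodule ℂ (complexBetti X (2 * r)) :=
  Submodule.span ℂ {c | ∃ a b : ℕ, a + b = 2 * r ∧ r ≤ a ∧ IsOfHodgeType n X (2 * r) a b c}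

/-! ### Predicates of a crystalline realization `C` (named-fact pattern: `C` an explicit binder) -/

section Crystalline

variable {p : ℕ} [Fact p.Prime] {k : Type} [Field k] [CharP k p] [PerfectRing k p]

/-- **Specialization of cycles** for the realization `C` (Fulton, *Intersection theory*, §20.3,
with Berthelot–Ogus 1983, §3 / Gillet–Messing 1987 for the compatibility of cycle classes with
`bo`): on every smooth proper `𝒳/W(k)`, every rational algebraic class of the GENERIC fibre is the
Berthelot–Ogus image of a rational algebraic class of the SPECIAL fibre. A theorem for the classical
realization; a predicate on `C` here. [cite: Fulton1998, §20.3] [cite: GilletMessing1987] -/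
def SpecializationOfCycles (C : CrystallineRealization p k) : Prop :=
  ∀ ⦃d : ℕ⦄ ⦃𝒳 : SchemeOver (WittVector p k)⦄, WittScheme.IsSmoothProperModel d 𝒳 →
    ∀ (r : ℕ) (x : C.dR.obj (WittScheme.genericFibre 𝒳) (2 * r)),
      x ∈ C.dR.ratAlgebraicClasses (WittScheme.genericFibre 𝒳) r →
      ∃ u ∈ C.ratAlgebraicClasses (WittScheme.specialFibre 𝒳) r, C.bo 𝒳 (2 * r) u = x

/-- **Divisor classes are Chern classes of line bundles** on the `k`-scheme `X`, relative to `C`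
(Gros 1985 / Gillet–Messing 1987: `cl(D) = c₁(𝒪(D))`): every rational divisor class is, up to
`N ≠ 0`, a `ℤ`-combination of `c₁ = ch₁` of rank-one modules. (`CrystallineRealization` has no
`⊗`-additivity of `c₁`, so the Pic-form "`N • u = c₁(L)` for ONE `L`" is NOT implied.)
[cite: Gros1985] [cite: GilletMessing1987] -/
def DivisorClassesAreChern (C : CrystallineRealization p k) (X : SchemeOver k) : Prop :=
  ∀ x ∈ C.ratAlgebraicClasses X 1, ∃ N : ℤ, N ≠ 0 ∧
    N • x ∈ AddSubgroup.closure {c | ∃ L : X.left.Modules, HasRank L 1 ∧ c = C.chCris X L 1}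

/-- **Rationally Lefschetz** `k`-scheme `X`, relative to `C` (the `ℚ`-form of Tate + Deuring for a
supersingular abelian variety; Lenstra–Zarhin 1993, §1: all classes are polynomials in divisor
classes): every rational algebraic class of codimension `r` is, up to `N ≠ 0`, a `ℤ`-combination of
`r`-th powers of rational divisor classes. [cite: LenstraZarhin1993, §1 pp. 179–180] -/
def RationallyLefschetz (C : CrystallineRealization p k) (X : SchemeOver k) : Prop :=
  ∀ (r : ℕ), ∀ x ∈ C.ratAlgebraicClasses X r, ∃ N : ℤ, N ≠ 0 ∧
    N • x ∈ AddSubgroup.closure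
      (Set.range fun D : C.ratAlgebraicClasses X 1 => C.pow X (D : C.obj X 2) r)

/-- **(⋆) CLASS-LIFTS-IMPLY-OBJECT-LIFTS** for a module `E₁` on the special fibre of `𝒳/W(k)` — the
hypothesis of the route crux `FormalLiftingFromClassLifting` of `PadicSemiregularLift`, VERBATIM
(`C`-free, real carriers: thickenings `X_n = 𝒳 ⊗ W/pⁿ`, `IsFiniteLocallyFree`, the Grothendieck group
`KZero`): for every `n` and every finite locally free `F` on `X_{n+1}` with `F|X_k ≅ E₁`, if
`[F] ∈ K₀(X_{n+1})` is the restriction of a class in `K₀(X_{n+2})` then `F` is the restriction of a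
finite locally free `F'` on `X_{n+2}` (the object-level form of the deformation problem
`K₀(X_{n+1}) → K₀(X_n)` of Bloch–Esnault–Kerz 2014, §1). A property of the pair `(𝒳, E₁)`, used only
as a hypothesis (in `starSeedClasses`). [cite: BlochEsnaultKerz2014pAdic, §1] -/
def ClassLiftsImplyObjectLifts (𝒳 : SchemeOver (WittVector p k))
    (E₁ : (WittScheme.specialFibre 𝒳).left.Modules) : Prop :=
  ∀ (n : ℕ) (F : (WittScheme.thickening 𝒳 (n + 1)).left.Modules) (hF : IsFiniteLocallyFree F),
    Nonempty ((Scheme.Modules.pullback (WittScheme.specialFibreToThickening 𝒳 n)).obj F ≅ E₁) →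
    (∃ y : KZero (WittScheme.thickening 𝒳 (n + 2)).left,
        KZero.map (WittScheme.thickeningMap 𝒳 (Nat.le_succ (n + 1))) y = KZero.of F hF) →
    ∃ F' : (WittScheme.thickening 𝒳 (n + 2)).left.Modules, IsFiniteLocallyFree F' ∧
      Nonempty ((Scheme.Modules.pullback (WittScheme.thickeningMap 𝒳 (Nat.le_succ (n + 1)))).obj F' ≅ F)

/-- The **standing hypotheses on the model** of the route crux `FormalLiftingFromClassLifting`,
VERBATIM (so that the crux is consumed by name): smooth proper of relative dimension `d`, projective
over `W` (`IsProjectiveOverRing`), `d + 6 < p`, `H^b(𝒳, 𝒪)` and `H^b(𝒳, Ω¹)` without `p`-torsion for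
all `b`, and `d ≤ 3` or `Ω¹` free (on paper: every `H^b(Ω^a)` torsion-free, Bloch–Esnault–Kerz 2014,
Rem. 35 (2) of the arXiv version; automatic for abelian schemes). [cite: BlochEsnaultKerz2014pAdic, Thm. 1.3] -/
structure ModelHypotheses (d : ℕ) (𝒳 : SchemeOver (WittVector p k)) : Prop where
  /-- `𝒳/W` is a smooth proper model of relative dimension `d` -/
  smoothProper : WittScheme.IsSmoothProperModel d 𝒳
  /-- `𝒳` is projective over the ring `W(k)` -/
  projective : IsProjectiveOverRing 𝒳
  /-- the Bloch–Esnault–Kerz bound -/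
  large : d + 6 < p
  /-- `H^b(𝒳, 𝒪)` has no `p`-torsion -/
  torsionFree_structureSheaf :
    ∀ (b : ℕ) (x : structureSheafCohomology 𝒳.left b), (p : ℤ) • x = 0 → x = 0
  /-- `H^b(𝒳, Ω¹)` has no `p`-torsion -/
  torsionFree_hodgeOne : ∀ (b : ℕ) (x : hodgeCohomologyOne 𝒳 b), (p : ℤ) • x = 0 → x = 0
  /-- `d ≤ 3` or `Ω¹_{𝒳/W}` is free of rank `d` -/
  cotangent_free : d ≤ 3 ∨
    Nonempty (cotangentSheaf 𝒳 ≅ SheafOfModules.free (R := 𝒳.left.ringCatSheaf) (Fin d))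

/-- The **(⋆)-seed classes** in degree `2r` on the special fibre of `𝒴`, relative to `C`: crystalline
Chern characters `ch_r(E)` of finite locally free `E` satisfying the Bloch–Esnault–Kerz Hodge
condition in ALL degrees (`C.HodgeCondition`, Thm. 1.3 (a)) and (⋆). [cite: BlochEsnaultKerz2014pAdic, Thm. 1.3 (a)] -/
def starSeedClasses (C : CrystallineRealization p k) (𝒴 : SchemeOver (WittVector p k)) (r : ℕ) :
    Set (C.obj (WittScheme.specialFibre 𝒴) (2 * r)) :=
  {x | ∃ (E : (WittScheme.specialFibre 𝒴).left.Modules) (_ : IsFiniteLocallyFree E),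
      C.HodgeCondition 𝒴 E ∧ ClassLiftsImplyObjectLifts 𝒴 E ∧
        x = C.chCris (WittScheme.specialFibre 𝒴) E r}

/-- **(⋆)-SEEDS for the model `𝒴`** of relative dimension `d`, relative to `C` (route-posited, the
seed statement of line `inner-form-invariant-seeds` at one model): every rational algebraic class `u`
of the special fibre in a MIDDLE codimension `1 ≤ r < d` whose Berthelot–Ogus image lies in `Fʳ` is,
up to `N ≠ 0`, a `ℤ`-combination of (⋆)-seed classes. [cite: BlochEsnaultKerz2014pAdic, Thm. 1.3] -/
def StarSeedsFor (C : CrystallineRealization p k) (d : ℕ) (𝒴 : SchemeOver (WittVector p k)) : Prop :=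
  ∀ (r : ℕ), 1 ≤ r → r < d → ∀ u ∈ C.ratAlgebraicClasses (WittScheme.specialFibre 𝒴) r,
    C.bo 𝒴 (2 * r) u ∈ C.dR.fil (2 * r) r →
    ∃ N : ℤ, N ≠ 0 ∧ N • u ∈ AddSubgroup.closure (starSeedClasses C 𝒴 r)

/-- The **formally liftable seed classes**: `ch_r(E)` of modules `E` on the special fibre that lift
to the `p`-adic formal completion of `𝒴` (`WittScheme.LiftsFormally`: a compatible system of vector
bundles on the thickenings; Berthelot–Ogus 1983, Thm. 3.8 for line bundles). [cite: BerthelotOgus1983, Thm. 3.8] -/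
def formalSeedClasses (C : CrystallineRealization p k) (𝒴 : SchemeOver (WittVector p k)) (r : ℕ) :
    Set (C.obj (WittScheme.specialFibre 𝒴) (2 * r)) :=
  {x | ∃ E : (WittScheme.specialFibre 𝒴).left.Modules, WittScheme.LiftsFormally 𝒴 E ∧
      x = C.chCris (WittScheme.specialFibre 𝒴) E r}

/-- **FORMAL SEEDS for `𝒴`** (the weaker seed statement: (⋆) + Hodge condition replaced by formal
liftability): every rational algebraic class of the special fibre in a middle codimension whose
Berthelot–Ogus image lies in `Fʳ` is, up to `N ≠ 0`, a `ℤ`-combination of formally liftable seed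
classes. [cite: BerthelotOgus1983, Thm. 3.8] -/
def FormalSeedsFor (C : CrystallineRealization p k) (d : ℕ) (𝒴 : SchemeOver (WittVector p k)) : Prop :=
  ∀ (r : ℕ), 1 ≤ r → r < d → ∀ u ∈ C.ratAlgebraicClasses (WittScheme.specialFibre 𝒴) r,
    C.bo 𝒴 (2 * r) u ∈ C.dR.fil (2 * r) r →
    ∃ N : ℤ, N ≠ 0 ∧ N • u ∈ AddSubgroup.closure (formalSeedClasses C 𝒴 r)

/-- **Rational `p`-adic variational Hodge for `𝒴` in the middle degrees**, relative to `C` (the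
class-level statement of Fontaine–Messing / Bloch–Esnault–Kerz 2014, §1, rationally; OPEN in print
for `r ≥ 2`, hence only ever a hypothesis or a target here): `u` rational algebraic on the special
fibre with `bo u ∈ Fʳ` ⟹ `bo u ∈ K · Aʳ(Y_K)`. [cite: BlochEsnaultKerz2014pAdic, §1] -/
def RationalPVHCFor (C : CrystallineRealization p k) (d : ℕ) (𝒴 : SchemeOver (WittVector p k)) : Prop :=
  ∀ (r : ℕ), 1 ≤ r → r < d → ∀ u ∈ C.ratAlgebraicClasses (WittScheme.specialFibre 𝒴) r,
    C.bo 𝒴 (2 * r) u ∈ C.dR.fil (2 * r) r →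
    C.bo 𝒴 (2 * r) u ∈ Submodule.span K(p, k)
      (C.dR.ratAlgebraicClasses (WittScheme.genericFibre 𝒴) r :
        Set (C.dR.obj (WittScheme.genericFibre 𝒴) (2 * r)))

/-- **(⋆)-seeds at the realization `C`** (over an algebraically closed `k`): the line's closed seed
statement `StarSeeds` with its outer binders `p, k, C` made the subject — granted Berthelot–Ogus 3.8
and Bloch–Esnault–Kerz 1.3 for `C`, every model `𝒴/W(k)` with `ModelHypotheses d 𝒴` whose special
fibre is a supersingular abelian variety with divisor-polynomial rational classes and Lenstra–Zarhin
has (⋆)-seeds (`StarSeedsFor C d 𝒴`). Route-posited and OPEN (the crux content of the abelian arm of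
`PadicSemiregularLift`); a predicate on `C`, to be quantified where obligations live:
`StarSeeds = ∀ p k … C, StarSeedsAt C`. [cite: BlochEsnaultKerz2014pAdic, Thm. 1.3] -/
def StarSeedsAt [IsAlgClosed k] (C : CrystallineRealization p k) : Prop :=
  C.BerthelotOgusLineBundleLifting → BlochEsnaultKerzLifting C →
    ∀ ⦃d : ℕ⦄ ⦃𝒴 : SchemeOver (WittVector p k)⦄ (A₀ : AbelianVariety k),
      ModelHypotheses d 𝒴 → A₀.X = WittScheme.specialFibre 𝒴 → A₀.IsSupersingular →
      DivisorClassesAreChern C (WittScheme.specialFibre 𝒴) →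
      RationallyLefschetz C (WittScheme.specialFibre 𝒴) →
      LenstraZarhin1993_supersingular_lefschetzClasses_eq_top C.toWeilCohomology A₀ →
      StarSeedsFor C d 𝒴

/-- **Formal seeds at the realization `C`** (fallback of `StarSeedsAt`: same hypotheses, conclusion
`FormalSeedsFor C d 𝒴`); `FormalSeeds = ∀ p k … C, FormalSeedsAt C`. [cite: BerthelotOgus1983, Thm. 3.8] -/
def FormalSeedsAt [IsAlgClosed k] (C : CrystallineRealization p k) : Prop :=
  C.BerthelotOgusLineBundleLifting → BlochEsnaultKerzLifting C →
    ∀ ⦃d : ℕ⦄ ⦃𝒴 : SchemeOver (WittVector p k)⦄ (A₀ : AbelianVariety k),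
      ModelHypotheses d 𝒴 → A₀.X = WittScheme.specialFibre 𝒴 → A₀.IsSupersingular →
      DivisorClassesAreChern C (WittScheme.specialFibre 𝒴) →
      RationallyLefschetz C (WittScheme.specialFibre 𝒴) →
      LenstraZarhin1993_supersingular_lefschetzClasses_eq_top C.toWeilCohomology A₀ →
      FormalSeedsFor C d 𝒴

/-- **Rational `p`-adic variational Hodge at the realization `C`** in the middle degrees of every
supersingular abelian model (the weakest fallback: same hypotheses, conclusion `RationalPVHCFor C d 𝒴`);
`RationalPVHC = ∀ p k … C, RationalPVHCAt C`. [cite: BlochEsnaultKerz2014pAdic, §1] -/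
def RationalPVHCAt [IsAlgClosed k] (C : CrystallineRealization p k) : Prop :=
  C.BerthelotOgusLineBundleLifting → BlochEsnaultKerzLifting C →
    ∀ ⦃d : ℕ⦄ ⦃𝒴 : SchemeOver (WittVector p k)⦄ (A₀ : AbelianVariety k),
      ModelHypotheses d 𝒴 → A₀.X = WittScheme.specialFibre 𝒴 → A₀.IsSupersingular →
      DivisorClassesAreChern C (WittScheme.specialFibre 𝒴) →
      RationallyLefschetz C (WittScheme.specialFibre 𝒴) →
      LenstraZarhin1993_supersingular_lefschetzClasses_eq_top C.toWeilCohomology A₀ →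
      RationalPVHCFor C d 𝒴

end Crystalline

/-! ### Genuineness of an anchor -/

namespace Anchor

variable {n : ℕ} {X : SchemeOver ℂ}

/-- **Genuineness** of an anchor `D`: exactly the classical facts about (model, crystalline
realization, de Rham realization, Berthelot–Ogus map, period comparison) that the composition of
line `inner-form-invariant-seeds` consumes — each a theorem in print for the CLASSICAL package at a
supersingular abelian-scheme model, recorded as hypotheses (named-fact pattern): the period
isomorphism (Grothendieck's algebraic de Rham theorem + GAGA), compatibility of `cmp` with cycle
classes and with the Hodge filtration (Deligne–Milne 1982, I §1), specialization of cycles, the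
divisor-class pinning and Lenstra–Zarhin on the special fibre, Berthelot–Ogus 3.8,
Bloch–Esnault–Kerz 1.3, and the model hypotheses of `FormalLiftingFromClassLifting` verbatim.
[cite: DeligneMilne1982, I §1] [cite: BerthelotOgus1983, Thm. 3.8] [cite: BlochEsnaultKerz2014pAdic, Thm. 1.3] -/
structure IsGenuine (D : Anchor n X) : Prop where
  /-- period isomorphism, spanning half: `ℂ · cmp (H_dR(Y_K/K)) = H(X(ℂ); ℂ)` -/
  periodSpan : ∀ i : ℕ, Submodule.span ℂ (Set.range (D.cmp i)) = ⊤
  /-- … and `cmp` is injective. -/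
  periodInjective : ∀ i : ℕ, Function.Injective (D.cmp i)
  /-- cycle classes: the period of an algebraic de Rham class lies in `algebraicClasses X r`. -/
  cycleCompatible : ∀ (r : ℕ) (x : D.C.dR.obj (WittScheme.genericFibre D.𝒴) (2 * r)),
    x ∈ D.C.dR.ratAlgebraicClasses (WittScheme.genericFibre D.𝒴) r →
      D.cmp (2 * r) x ∈ algebraicClasses X r
  /-- Hodge filtration: `cmp (Fʳ H²ʳ_dR) ⊆ Fʳ H²ʳ_B` … -/
  filCompatible : ∀ (r : ℕ) (x : D.C.dR.obj (WittScheme.genericFibre D.𝒴) (2 * r)),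
    x ∈ D.C.dR.fil (2 * r) r → D.cmp (2 * r) x ∈ bettiHodgeFil n X r
  /-- … and `Fʳ H²ʳ_B ⊆ ℂ · cmp (Fʳ H²ʳ_dR)`. -/
  filSpans : ∀ r : ℕ, bettiHodgeFil n X r ≤
    Submodule.span ℂ (D.cmp (2 * r) ''
      (D.C.dR.fil (X := WittScheme.genericFibre D.𝒴) (2 * r) r :
        Set (D.C.dR.obj (WittScheme.genericFibre D.𝒴) (2 * r))))
  /-- specialization of cycles, for all smooth proper models -/
  specialization : SpecializationOfCycles D.C
  /-- divisor classes of the special fibre are `c₁` of line bundles … -/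
  divisorClasses : DivisorClassesAreChern D.C (WittScheme.specialFibre D.𝒴)
  /-- … every rational algebraic class of the supersingular special fibre is a rational divisor
  polynomial … -/
  rationallyLefschetz : RationallyLefschetz D.C (WittScheme.specialFibre D.𝒴)
  /-- … and they `K`-span cohomology (the tree's Lenstra–Zarhin fact at `D.C`, `D.A₀`). -/
  lefschetz : LenstraZarhin1993_supersingular_lefschetzClasses_eq_top D.C.toWeilCohomology D.A₀
  /-- Berthelot–Ogus 1983, Thm. 3.8 at `D.C`. -/
  lineBundles : D.C.BerthelotOgusLineBundleLifting
  /-- Bloch–Esnault–Kerz 2014, Thm. 1.3 at `D.C`. -/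
  bek : BlochEsnaultKerzLifting D.C
  /-- model hypothesis: `𝒴` is projective over `W(k)` (an abelian scheme over a DVR is). -/
  projective : IsProjectiveOverRing D.𝒴
  /-- model hypothesis: `H^b(𝒴, 𝒪)` has no `p`-torsion (abelian scheme: `∧^b` of a free module). -/
  torsionFree_structureSheaf :
    ∀ (b : ℕ) (x : structureSheafCohomology D.𝒴.left b), (D.p : ℤ) • x = 0 → x = 0
  /-- model hypothesis: `H^b(𝒴, Ω¹)` has no `p`-torsion. -/
  torsionFree_hodgeOne : ∀ (b : ℕ) (x : hodgeCohomologyOne D.𝒴 b), (D.p : ℤ) • x = 0 → x = 0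
  /-- model hypothesis: `n ≤ 3` or `Ω¹_{𝒴/W}` is free (abelian scheme: invariant differentials). -/
  cotangent_free : n ≤ 3 ∨
    Nonempty (cotangentSheaf D.𝒴 ≅ SheafOfModules.free (R := D.𝒴.left.ringCatSheaf) (Fin n))

end Anchor

/-! ### Complex side (real carriers: families over `ℚ̄`, `fiberOver`, `complexBetti`) -/

/-- `s ∈ S(ℂ)` is **`ℚ̄`-generic**: it lies on no proper subset of the complex points of
`S = S₀ ⊗_σ ℂ` that is Zariski closed and defined over `ℚ̄` (`IsDefinedOverQbar`; Lang's `k`-closed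
sets) — the genericity hypothesis of the route item `HodgeLocusPropagation`, verbatim.
[cite: Lang1958IAG, Ch. III §5, C4–C7] -/
def IsQbarGeneric (σ : AlgebraicClosure ℚ →+* ℂ) (S₀ : SchemeOver (AlgebraicClosure ℚ))
    (s : ComplexPoints ((baseChangeHom σ).obj S₀)) : Prop :=
  ∀ Z : Set (ComplexPoints ((baseChangeHom σ).obj S₀)), IsDefinedOverQbar σ S₀ Z → s ∈ Z → Z = Set.univ

/-- **The Hodge classes of `A ≅ 𝒳_t` extend to global classes on the total space that are still
rational Hodge classes on the fibre at `s`** (what the global invariant cycle theorem, Deligne,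
*Hodge II*, Thm. 4.1.1 / Charles–Schnell Thm. 11.3.4 and Prop. 11.3.5, supplies over a base on which
the classes have finite monodromy). [cite: DeligneHodgeII1971, Théorème 4.1.1] [cite: CharlesSchnell2014Notes, Theorem 11.3.4] -/
def ExtendsHodgeClasses (A : AbelianVariety ℂ) {𝒳 S : SchemeOver ℂ} (f : 𝒳 ⟶ S)
    (t s : ComplexPoints S) (eA : A.X ≅ fiberOver f t) : Prop :=
  ∀ (p : ℕ) (c : complexBetti A.X (2 * p)), IsRationalClass c → IsOfHodgeType A.dim A.X (2 * p) p p c →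
    ∃ 𝔄 : complexBetti 𝒳 (2 * p),
      complexBetti.map eA.hom (2 * p) (complexBetti.map (fiberι f t) (2 * p) 𝔄) = c ∧
      IsRationalClass (complexBetti.map (fiberι f s) (2 * p) 𝔄) ∧
      IsOfHodgeType A.dim (fiberOver f s) (2 * p) p p (complexBetti.map (fiberι f s) (2 * p) 𝔄)

/-- The `ℂ`-span of the rational `(r,r)`-classes of `X` (the Hodge classes `Hdg^{2r}(X) ⊗ ℂ`).
[cite: Deligne2000, §1] -/
def hodgeSpan (n : ℕ) (X : SchemeOver ℂ) (r : ℕ) : Submodule ℂ (complexBetti X (2 * r)) :=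
  Submodule.span ℂ {c | IsRationalClass c ∧ IsOfHodgeType n X (2 * r) r r c}

/-- The **middle cycle part** for the complex `n`-fold `X`: in every MIDDLE codimension `1 ≤ r < n`,
every rational class of Hodge type `(r,r)` lies in `algebraicClasses X r` (Deligne's cycle-part
statement, restricted to the middle degrees; a predicate on `(n, X)`, the target of the transfer
`Anchor.middleCyclePart_of_rationalPVHCFor`). [cite: Deligne2000, §1] -/
def MiddleCyclePart (n : ℕ) (X : SchemeOver ℂ) : Prop :=
  ∀ (r : ℕ), 1 ≤ r → r < n → ∀ c : complexBetti X (2 * r), IsRationalClass c →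
    IsOfHodgeType n X (2 * r) r r c → c ∈ algebraicClasses X r

/-! ### The residual of the inner-form lever at one anchor -/

namespace Anchor

variable {n : ℕ} {X : SchemeOver ℂ}

/-- `H_K := cmp⁻¹ (Hdg ⊗ ℂ)`: the `K`-rational de Rham classes of `Y_K` whose period lies in the span of
the Hodge classes of `X`. [cite: Deligne1982HodgeCycles, Main Thm. 2.11] -/
def hodgeDR (D : Anchor n X) (r : ℕ) :
    Submodule K(D.p, D.k) (D.C.dR.obj (WittScheme.genericFibre D.𝒴) (2 * r)) :=
  (hodgeSpan n X r).comap (D.cmp (2 * r))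

/-- **Residual `R_desc`** (descent of the Hodge span to `K`): every rational `(r,r)`-class of `X` lies
in the `ℂ`-span of the periods of `H_K` (absolute Hodge classes on abelian varieties, Deligne 1982,
Main Thm. 2.11, with inertia acting trivially by good reduction over `W(k)`; crystalline incarnation
Blasius 1994 / Ogus 1982, §4). A predicate on `D`. [cite: Deligne1982HodgeCycles, Main Thm. 2.11] [cite: Ogus1982, §4] -/
def HodgeSpanDescends (D : Anchor n X) : Prop :=
  ∀ (r : ℕ) (c : complexBetti X (2 * r)), IsRationalClass c → IsOfHodgeType n X (2 * r) r r c →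
    c ∈ Submodule.span ℂ (D.cmp (2 * r) ''
      (D.hodgeDR r : Set (D.C.dR.obj (WittScheme.genericFibre D.𝒴) (2 * r))))

/-- **Residual `R_inv`** (Kisin's inner-form identity `H_K ≤ K · bo (U_Hdg)`): at a basic point `x` of a
hyperspecial integral canonical model, Kisin's group `I = I_x` (automorphisms of `A_x` fixing all
crystalline tensors `s_{α,0,x}`; Kisin 2017, (2.1.2), Cor. 2.3.2: `I ⊗ ℚ_p ≅ I_p ⊂ J_δ`, Cor. 2.3.5:
an inner form) has `U^{I_x} ⊗ ℚ_p = Hdg ⊗ ℚ_p` on the Lefschetz algebra of the special fibre, whence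
the Hodge classes of the generic member are `K`-spanned by `bo` of `I_x`-invariant rational divisor
polynomials that are Hodge at the lift. In print ONLY at such anchors; a predicate on `D`.
[cite: Kisin2017, §2.1 (2.1.2) and Cor. 2.3.2, 2.3.5] -/
def InnerFormIdentity (D : Anchor n X) : Prop :=
  ∀ r : ℕ, D.hodgeDR r ≤ Submodule.span K(D.p, D.k) (D.C.bo D.𝒴 (2 * r) '' D.UHdg r)

/-- **B2 / the tight form** (double genericity at the anchor): the period of every `U_Hdg` class lies
in the `ℂ`-span of the rational `(r,r)`-classes of `X`. [cite: Deligne1982HodgeCycles, Main Thm. 2.11] -/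
def UHdgAreHodge (D : Anchor n X) : Prop :=
  ∀ (r : ℕ), ∀ u ∈ D.UHdg r, D.cmp (2 * r) (D.C.bo D.𝒴 (2 * r) u) ∈ hodgeSpan n X r

/-- **Cycle descent** at the anchor (Deligne–Milne 1982, I §1 with Hilbert-scheme spreading: algebraic
classes on `X = Y_K ⊗_ι ℂ` are `ℂ`-spanned by classes of cycles over `K̄`, and Galois-orbit sums
descend to `K`): a `K`-rational de Rham class whose period is algebraic on `X` is a `K`-combination of
`K`-rational algebraic de Rham classes of `Y_K`. A predicate on `D`. [cite: DeligneMilne1982, I §1] -/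
def CycleDescent (D : Anchor n X) : Prop :=
  ∀ (r : ℕ) (x : D.C.dR.obj (WittScheme.genericFibre D.𝒴) (2 * r)),
    D.cmp (2 * r) x ∈ algebraicClasses X r →
      x ∈ Submodule.span K(D.p, D.k)
        (D.C.dR.ratAlgebraicClasses (WittScheme.genericFibre D.𝒴) r :
          Set (D.C.dR.obj (WittScheme.genericFibre D.𝒴) (2 * r)))

end Anchor

/-! ### Inner-form anchors of a complex abelian variety -/

/-- **Inner-form anchors for the complex abelian variety `A`** (the line's closed statement
`InnerFormAnchors` with its outer binder `A` made the subject; `InnerFormAnchors = ∀ A,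
InnerFormAnchorsFor A`): there are `σ : ℚ̄ → ℂ`, a smooth projective family `f₀ : 𝒳₀ → S₀` over an
irreducible quasi-projective `ℚ̄`-base, points `t, s ∈ S(ℂ)` with `A ≅ 𝒳_t` and `s` `ℚ̄`-GENERIC, such
that every rational `(p,p)`-class of `A` is the restriction of a global class whose restriction to
`𝒳_s` is again rational of type `(p,p)`, AND a GENUINE, SPANNING anchor of `𝒳_s`. On paper (assembly
of published results, not formalized): a neat-level Hodge-type Shimura variety through `A` over its
smallest special subvariety, global classes by the fixed-part theorem, a hyperspecial `p > dim A + 6`,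
a basic (supersingular) point of Kisin's integral canonical model (Kisin 2017, §1–§2; Kisin–Madapusi
Pera–Shin 2022) and a generic `W(𝔽̄_p)`-lift of it, the classical crystalline/de Rham/period package,
and the lever `HodgeSpanDescends ∧ InnerFormIdentity ⊢ SpansHodge` (`Anchor.spansHodge_of_residual`).
A predicate on `A`, never asserted here. [cite: Kisin2017, §2.1 (2.1.2) and Cor. 2.3.2, 2.3.5] [cite: KisinMadapusiperaShin2022] -/
def InnerFormAnchorsFor (A : AbelianVariety ℂ) : Prop :=
  ∃ (σ : AlgebraicClosure ℚ →+* ℂ) (𝒳₀ S₀ : SchemeOver (AlgebraicClosure ℚ)) (f₀ : 𝒳₀ ⟶ S₀)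
    (t s : ComplexPoints ((baseChangeHom σ).obj S₀))
    (eA : A.X ≅ fiberOver ((baseChangeHom σ).map f₀) t),
    IsQuasiProjectiveOver S₀ ∧ IrreducibleSpace S₀.left ∧
    IsSmoothProjectiveFamily ((baseChangeHom σ).map f₀) A.dim ∧
    IsQbarGeneric σ S₀ s ∧
    ExtendsHodgeClasses A ((baseChangeHom σ).map f₀) t s eA ∧
    ∃ D : Anchor A.dim (fiberOver ((baseChangeHom σ).map f₀) s), D.IsGenuine ∧ D.SpansHodge

/-! ### Proved glue at one anchor (pure linear algebra) -/

section SemilinearSpan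

variable {R S M N : Type*} [Semiring R] [Semiring S] {τ : R →+* S} [AddCommMonoid M]
  [AddCommMonoid N] [Module R M] [Module S N]

/-- A `τ`-semilinear map sends the `R`-span of `s` into the `S`-span of `f '' s` (Mathlib's
`Submodule.apply_mem_span_image_of_mem_span` needs `RingHomSurjective τ`, which `ι : K → ℂ` is not).
[folklore] -/
theorem semilinear_apply_mem_span_image (f : M →ₛₗ[τ] N) {s : Set M} {x : M}
    (hx : x ∈ Submodule.span R s) : f x ∈ Submodule.span S (f '' s) := by
  induction hx using Submodule.span_induction with
  | mem y hy => exact Submodule.subset_span ⟨y, hy, rfl⟩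
  | zero => rw [map_zero]; exact Submodule.zero_mem _
  | add y z _ _ hy hz => rw [map_add]; exact Submodule.add_mem _ hy hz
  | smul a y _ hy => rw [LinearMap.map_smulₛₗ]; exact Submodule.smul_mem _ _ hy

end SemilinearSpan

namespace Anchor

variable {n : ℕ} {X : SchemeOver ℂ} (D : Anchor n X)

/-- A genuine anchor satisfies the model hypotheses of `FormalLiftingFromClassLifting` in relative
dimension `n`. [folklore] -/
theorem modelHypotheses (hD : D.IsGenuine) : ModelHypotheses n D.𝒴 :=
  ⟨D.model, hD.projective, D.large, hD.torsionFree_structureSheaf, hD.torsionFree_hodgeOne,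
    hD.cotangent_free⟩

/-- Rational pVHC in the middle degrees at a genuine anchor, from the ∀-model statement at its
realization. [folklore] -/
theorem rationalPVHCFor_of_rationalPVHCAt (h : RationalPVHCAt D.C) (hD : D.IsGenuine) :
    RationalPVHCFor D.C n D.𝒴 :=
  h hD.lineBundles hD.bek D.A₀ (D.modelHypotheses hD) D.special_eq D.supersingular
    hD.divisorClasses hD.rationallyLefschetz hD.lefschetz

/-- **Formal reduction of the lever**: `R_desc ∧ R_inv ⊢ SpansHodge` — pure semilinear algebra; the
exact shape of what Kisin's inner form supplies on paper at the anchors of `InnerFormAnchorsFor`.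
[folklore] -/
theorem spansHodge_of_residual (h₁ : D.HodgeSpanDescends) (h₂ : D.InnerFormIdentity) :
    D.SpansHodge := by
  intro r c hc hH
  refine Submodule.span_le.2 ?_ (h₁ r c hc hH)
  rintro _ ⟨x, hx, rfl⟩
  have h := semilinear_apply_mem_span_image (D.cmp (2 * r)) (h₂ r hx)
  rw [Set.image_image] at h
  exact h

/-- At an anchor with compatible cycle classes, rational pVHC in degree `r` makes every class of
`cmp ∘ bo (U_Hdg r)` algebraic on `X`. [folklore] -/
theorem anchoredClasses_subset_algebraicClasses (hcc : ∀ (r : ℕ)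
      (x : D.C.dR.obj (WittScheme.genericFibre D.𝒴) (2 * r)),
      x ∈ D.C.dR.ratAlgebraicClasses (WittScheme.genericFibre D.𝒴) r →
        D.cmp (2 * r) x ∈ algebraicClasses X r) {r : ℕ}
    (hR : ∀ u ∈ D.UHdg r, D.C.bo D.𝒴 (2 * r) u ∈ Submodule.span K(D.p, D.k)
      (D.C.dR.ratAlgebraicClasses (WittScheme.genericFibre D.𝒴) r :
        Set (D.C.dR.obj (WittScheme.genericFibre D.𝒴) (2 * r)))) :
    D.anchoredClasses r ⊆ algebraicClasses X r := by
  rintro _ ⟨u, hu, rfl⟩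
  have hle : Submodule.span K(D.p, D.k)
      (D.C.dR.ratAlgebraicClasses (WittScheme.genericFibre D.𝒴) r :
        Set (D.C.dR.obj (WittScheme.genericFibre D.𝒴) (2 * r))) ≤
      (algebraicClasses X r).comap (D.cmp (2 * r)) :=
    Submodule.span_le.2 fun x hx => hcc r x hx
  exact hle (hR u hu)

/-- **Transfer at one anchor, middle degrees** (⟹): genuineness + SPANNING + rational pVHC in the
middle degrees give the cycle part of the Hodge conjecture for `X` in every middle codimension.
[folklore] -/
theorem middleCyclePart_of_rationalPVHCFor (hD : D.IsGenuine) (hS : D.SpansHodge)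
    (hR : RationalPVHCFor D.C n D.𝒴) : MiddleCyclePart n X :=
  fun r h1 hr c hc hH => Submodule.span_le.2 (D.anchoredClasses_subset_algebraicClasses
    hD.cycleCompatible (fun u hu => hR r h1 hr u hu.1 hu.2)) (hS r c hc hH)

/-- **⟸**: the cycle part of HC for the anchored fibre in the middle degrees, B2 and cycle descent
give `RationalPVHCFor` back at the anchor (`cmp (bo u) ∈ Hdg ⊗ ℂ ≤ algebraicClasses`, then descend).
[folklore] -/
theorem rationalPVHCFor_of_middleCyclePart (hB2 : D.UHdgAreHodge) (hdesc : D.CycleDescent)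
    (hHC : MiddleCyclePart n X) : RationalPVHCFor D.C n D.𝒴 := by
  intro r h1 hr u hu hfil
  refine hdesc r _ ?_
  have hle : hodgeSpan n X r ≤ algebraicClasses X r :=
    Submodule.span_le.2 fun c hc => hHC r h1 hr c hc.1 hc.2
  exact hle (hB2 r u ⟨hu, hfil⟩)

/-- **TIGHTNESS at a genuine, spanning, tight anchor with cycle descent**: rational pVHC in the middle
degrees at the anchor is EQUIVALENT to the cycle part of the Hodge conjecture for the anchored complex
variety in the middle codimensions. [folklore] -/
theorem rationalPVHCFor_iff_middleCyclePart (hD : D.IsGenuine) (hS : D.SpansHodge)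
    (hB2 : D.UHdgAreHodge) (hdesc : D.CycleDescent) :
    RationalPVHCFor D.C n D.𝒴 ↔ MiddleCyclePart n X :=
  ⟨D.middleCyclePart_of_rationalPVHCFor hD hS, D.rationalPVHCFor_of_middleCyclePart hB2 hdesc⟩

end Anchor

end Literature.AlgebraicGeometry.Crystalline.PadicAnchor

end
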